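import Literature.Geometry.Symplectic.SphereACData
import Literature.Geometry.Symplectic.AlmostComplexThroughImmersion
import Literature.Geometry.Symplectic.ProjectiveLineProductCharts
import HarnessLib

/-!
# The chart data `SphereACData` of an almost complex structure through a product neighbourhood

Layer B6d of the analytic core of the Hofer–Lizan–Sikorav local foliation theorem (Wendl 2018,
Thm. 2.46 / Prop. 2.53; lead of crux `WitnessCharge`, summit `SmoothPoincare4`): the manifold
bookkeeping that instantiates the lead's structure `SphereCR.SphereACData` (`SphereACData.lean`)
from a product neighbourhood of an embedded `J`-holomorphic sphere.

Setting. `X` is a `C^∞` `4`-manifold with a `C^∞` almost complex structure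
`JX : AlmostComplexStructure (𝓡 4) ∞ X`; `ι : ℂℙ¹ × ℂ → X` is a `C^∞` immersion (injective
differential everywhere; typically the product-neighbourhood embedding of an embedded sphere with
trivial normal bundle, `helper_productNbhd` on the summit side) whose zero section `ι (θ, 0) = F₀ θ`
is the glued map of a two-chart sphere `(u₀, v₀)` (`F₀ = u₀ ∘ affineCoordComplex 0` on `{p₀ ≠ 0}`,
`F₀ = v₀ ∘ affineCoordComplex 1` on `{p₁ ≠ 0}`), both charts `JX`-holomorphic
(`IsJHolomorphic`). The two product charts are `prodChart i ι (z, t) = ι (linePt i z, t)`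
(`ProjectiveLineProductCharts.lean`), `C^∞` immersions `ℂ × ℂ → X` related by the chart change
`psi (Z, t) = (Z⁻¹, t)` off `{Z = 0}`.

Results (namespace `Literature.Geometry.Symplectic.SphereCR`).

* `exists_coordJ_prodChart`: the coordinate expression `Jc` of `JX` through `prodChart i ι`
  (`exists_coordJ_of_immersion'` on `W = univ`): `C^∞`, `Jc² = -1`, and
  `d(prodChart i ι)_q ∘ Jc q = JX ∘ d(prodChart i ι)_q`; unique (`coordJ_prodChart_unique`).
* `compat_of_intertwine`: two such expressions `J₀`, `J₁` through `prodChart 0 ι`, `prodChart 1 ι`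
  satisfy `J₁ (psi x) ∘ dpsi_x = dpsi_x ∘ J₀ x` for `x.1 ≠ 0` (chain rule across
  `prodChart 1 ι = prodChart 0 ι ∘ psi`, `psi ∘ psi = id`, and injectivity of `d(prodChart 1 ι)`).
* `axis_of_intertwine`: if `prodChart i ι (z, 0) = w z` with `w` `JX`-holomorphic, then
  `Jc (Z, 0) (ζ, 0) = (I ζ, 0)` (transfer of `J`-holomorphicity, `isJHolomorphic_comp_iff_coord`,
  to the coordinate curve `z ↦ (z, 0)`).
* `exists_sphereACData_of_productNbhd`: **the `SphereACData` of the product neighbourhood** — a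
  `𝒥 : SphereACData` whose `J₀`, `J₁` are intertwined with `JX` by the differentials of the two
  product charts (and are determined by this, `coordJ_prodChart_unique`: the data are canonical).
* Re-exports under the present hypotheses, for feeding the transfer lemmas of
  `AlmostComplexThroughImmersion.lean`: `contMDiff_prodChart_zero/one`,
  `injective_mfderiv_prodChart_zero/one`, `prodChart_zero_axis` (`prodChart 0 ι (z, 0) = u₀ z`),
  `prodChart_one_axis`, the chain rule `mfderiv_prodChart_one_psi_apply` across the chart change,
  and the pre-instantiated transfer
  `isJHolomorphic_prodChart_comp_iff` / `isJHolomorphicAt_prodChart_comp_iff`: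
  `prodChart i ι ∘ v` is `JX`-holomorphic iff `v` is flat `Jc`-holomorphic.

Deliberately NOT here: any analysis (the Cauchy–Riemann operator built on `𝒥` is
`SphereCROperatorPointwise.lean`), injectivity of `ι`, the construction of `ι`, and a named
choice of `𝒥` (users destructure the existential; uniqueness is `coordJ_prodChart_unique`).

## References

* C. Wendl, *Holomorphic Curves in Low Dimensions*, LNM 2216 (2018), §2.3, Thm. 2.46,
  Prop. 2.53. [Wendl2018]
* D. McDuff, D. Salamon, *J-holomorphic Curves and Symplectic Topology*, 2nd ed. (2012), §2.2,
  §3.1. [McDuffSalamon2012]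
-/

noncomputable section

open scoped Manifold ContDiff Topology
open Set Function Filter
open Literature.Topology.FourManifolds Literature.Topology.FourManifolds.ComplexProjectiveSpace

namespace Literature.Geometry.Symplectic

namespace SphereCR

variable {X : Type*} {ι : ComplexProjectiveSpace 1 × ℂ → X}

/-! ### The chart change and the product charts: re-exports and complements -/

section Algebra

/-- `psi` is an involution (everywhere, with the junk value `0⁻¹⁻¹ = 0`). [folklore] -/
@[simp] theorem psi_psi (x : ℂ × ℂ) : psi (psi x) = x := by
  simp [psi]

/-- The first coordinate of `psi x` is `x.1⁻¹`. [folklore] -/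
@[simp] theorem psi_fst (x : ℂ × ℂ) : (psi x).1 = x.1⁻¹ := rfl

/-- The second coordinate of `psi x` is `x.2`. [folklore] -/
@[simp] theorem psi_snd (x : ℂ × ℂ) : (psi x).2 = x.2 := rfl

/-- `dpsi_{psi x} ∘ dpsi_x = id` for `x.1 ≠ 0` (the chain rule for the involution `psi`).
[folklore] -/
theorem dPsi_psi_apply_dPsi {x : ℂ × ℂ} (hx : x.1 ≠ 0) (v : ℂ × ℂ) :
    dPsi (psi x) (dPsi x v) = v := by
  ext
  · simp only [dPsi_apply, psi_fst, inv_pow, inv_inv, neg_mul, mul_neg, neg_neg]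
    rw [← mul_assoc, mul_inv_cancel₀ (pow_ne_zero 2 hx), one_mul]
  · simp

/-- **`prodChart 1 ι = prodChart 0 ι ∘ psi` off `{W = 0}`** (`prodChart_one_eq`). [folklore] -/
theorem prodChart_one_eq_prodChart_zero_psi (ι : ComplexProjectiveSpace 1 × ℂ → X) {y : ℂ × ℂ}
    (hy : y.1 ≠ 0) : prodChart 1 ι y = prodChart 0 ι (psi y) :=
  prodChart_one_eq ι hy

/-- Along `t = 0` the product chart `0` is the chart `u₀` of the central two-chart sphere:
`prodChart 0 ι (z, 0) = u₀ z` (`prodChart_zero_zero_eq`, for a bundled `F₀`). [folklore] -/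
theorem prodChart_zero_axis [TopologicalSpace X] {u₀ : ℂ → X}
    {F₀ : C(ComplexProjectiveSpace 1, X)}
    (hF₀u : ∀ p, CoordNeZero 0 p → F₀ p = u₀ (affineCoordComplex 0 p 0))
    (hιF : ∀ θ, ι (θ, 0) = F₀ θ) (z : ℂ) : prodChart 0 ι (z, 0) = u₀ z :=
  prodChart_zero_zero_eq hF₀u hιF z

/-- Along `t = 0` the product chart `1` is the chart `v₀` of the central two-chart sphere:
`prodChart 1 ι (w, 0) = v₀ w` (`prodChart_one_zero_eq`, for a bundled `F₀`). [folklore] -/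
theorem prodChart_one_axis [TopologicalSpace X] {v₀ : ℂ → X}
    {F₀ : C(ComplexProjectiveSpace 1, X)}
    (hF₀v : ∀ p, CoordNeZero 1 p → F₀ p = v₀ (affineCoordComplex 1 p 0))
    (hιF : ∀ θ, ι (θ, 0) = F₀ θ) (w : ℂ) : prodChart 1 ι (w, 0) = v₀ w :=
  prodChart_one_zero_eq hF₀v hιF w

end Algebra

section Charts

variable [TopologicalSpace X] [ChartedSpace (EuclideanSpace ℝ (Fin 4)) X]

/-- `prodChart 0 ι` is `C^∞` when `ι` is (`contMDiff_prodChart`). [folklore] -/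
theorem contMDiff_prodChart_zero (hι : ContMDiff ((𝓡 2).prod 𝓘(ℝ, ℂ)) (𝓡 4) ∞ ι) :
    ContMDiff 𝓘(ℝ, ℂ × ℂ) (𝓡 4) ∞ (prodChart 0 ι) :=
  contMDiff_prodChart 0 hι

/-- `prodChart 1 ι` is `C^∞` when `ι` is (`contMDiff_prodChart`). [folklore] -/
theorem contMDiff_prodChart_one (hι : ContMDiff ((𝓡 2).prod 𝓘(ℝ, ℂ)) (𝓡 4) ∞ ι) :
    ContMDiff 𝓘(ℝ, ℂ × ℂ) (𝓡 4) ∞ (prodChart 1 ι) :=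
  contMDiff_prodChart 1 hι

/-- `prodChart 0 ι` is an immersion when `ι` is a `C^∞` immersion
(`injective_mfderiv_prodChart`). [folklore] -/
theorem injective_mfderiv_prodChart_zero (hι : ContMDiff ((𝓡 2).prod 𝓘(ℝ, ℂ)) (𝓡 4) ∞ ι)
    (hιimm : ∀ q, Injective (mfderiv ((𝓡 2).prod 𝓘(ℝ, ℂ)) (𝓡 4) ι q)) (q : ℂ × ℂ) :
    Injective (mfderiv 𝓘(ℝ, ℂ × ℂ) (𝓡 4) (prodChart 0 ι) q) :=
  injective_mfderiv_prodChart 0 hι hιimm q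

/-- `prodChart 1 ι` is an immersion when `ι` is a `C^∞` immersion
(`injective_mfderiv_prodChart`). [folklore] -/
theorem injective_mfderiv_prodChart_one (hι : ContMDiff ((𝓡 2).prod 𝓘(ℝ, ℂ)) (𝓡 4) ∞ ι)
    (hιimm : ∀ q, Injective (mfderiv ((𝓡 2).prod 𝓘(ℝ, ℂ)) (𝓡 4) ι q)) (q : ℂ × ℂ) :
    Injective (mfderiv 𝓘(ℝ, ℂ × ℂ) (𝓡 4) (prodChart 1 ι) q) :=
  injective_mfderiv_prodChart 1 hι hιimm q

/-- **Chain rule across the chart change, at `psi x`**: for `x.1 ≠ 0`,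
`d(prodChart 1 ι)_{psi x} w = d(prodChart 0 ι)_x (dpsi_{psi x} w)`
(`mfderiv_prodChart_one_apply_of_ne` at the point `psi x`, using `psi (psi x) = x`). [folklore] -/
theorem mfderiv_prodChart_one_psi_apply (hι : ContMDiff ((𝓡 2).prod 𝓘(ℝ, ℂ)) (𝓡 4) ∞ ι)
    {x : ℂ × ℂ} (hx : x.1 ≠ 0) (w : ℂ × ℂ) :
    mfderiv 𝓘(ℝ, ℂ × ℂ) (𝓡 4) (prodChart 1 ι) (psi x) w =
      mfderiv 𝓘(ℝ, ℂ × ℂ) (𝓡 4) (prodChart 0 ι) x (dPsi (psi x) w) := by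
  have hy : (psi x).1 ≠ 0 := inv_ne_zero hx
  have hyx : (((psi x).1⁻¹, (psi x).2) : ℂ × ℂ) = x := psi_psi x
  have hd : MDifferentiableAt 𝓘(ℝ, ℂ × ℂ) (𝓡 4) (prodChart 0 ι) ((psi x).1⁻¹, (psi x).2) := by
    rw [hyx]
    exact (contMDiff_prodChart 0 hι _).mdifferentiableAt (by simp)
  rw [mfderiv_prodChart_one_apply_of_ne hy hd w, dPsi_apply, hyx]

end Charts

/-! ### The coordinate expressions of `JX` through the product charts -/

section CoordJ

variable [TopologicalSpace X] [ChartedSpace (EuclideanSpace ℝ (Fin 4)) X] [IsManifold (𝓡 4) ∞ X]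
  (JX : AlmostComplexStructure (𝓡 4) ∞ X)

/-- **The coordinate expression of `JX` through a product chart**: for a `C^∞` immersion
`ι : ℂℙ¹ × ℂ → X` there is a `C^∞` field `Jc : ℂ × ℂ → End_ℝ(ℂ × ℂ)` with `Jc² = -1` and
`d(prodChart i ι)_q (Jc q v) = JX (d(prodChart i ι)_q v)` (`exists_coordJ_of_immersion'` for
`κ = prodChart i ι` on `W = univ`; Wendl 2018, §2.2–2.3: the structure read in the product
coordinates). [cite: Wendl2018, §2.3] -/
theorem exists_coordJ_prodChart (i : Fin 2) (hι : ContMDiff ((𝓡 2).prod 𝓘(ℝ, ℂ)) (𝓡 4) ∞ ι)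
    (hιimm : ∀ q, Injective (mfderiv ((𝓡 2).prod 𝓘(ℝ, ℂ)) (𝓡 4) ι q)) :
    ∃ Jc : ℂ × ℂ → ℂ × ℂ →L[ℝ] ℂ × ℂ, ContDiff ℝ ∞ Jc ∧ (∀ q v, Jc q (Jc q v) = -v) ∧
      ∀ q v, mfderiv 𝓘(ℝ, ℂ × ℂ) (𝓡 4) (prodChart i ι) q (Jc q v) =
        JX (prodChart i ι q) (mfderiv 𝓘(ℝ, ℂ × ℂ) (𝓡 4) (prodChart i ι) q v) := by
  obtain ⟨Jc, hs, hsq, hint⟩ := exists_coordJ_of_immersion' JX finrank_real_complex_prod_eq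
    (prodChart i ι) univ isOpen_univ (contMDiff_prodChart i hι).contMDiffOn
    fun q _ => injective_mfderiv_prodChart i hι hιimm q
  exact ⟨Jc, contDiffOn_univ.1 hs, fun q v => hsq q (mem_univ q) v,
    fun q v => hint q (mem_univ q) v⟩

/-- **Uniqueness of the coordinate expression through a product chart**: an endomorphism
intertwined with `JX (prodChart i ι q)` by `d(prodChart i ι)_q` is unique (`coordJ_unique`,
`d(prodChart i ι)_q` being injective). [folklore] -/
theorem coordJ_prodChart_unique (i : Fin 2) (hι : ContMDiff ((𝓡 2).prod 𝓘(ℝ, ℂ)) (𝓡 4) ∞ ι)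
    (hιimm : ∀ q, Injective (mfderiv ((𝓡 2).prod 𝓘(ℝ, ℂ)) (𝓡 4) ι q)) {q : ℂ × ℂ}
    {T T' : ℂ × ℂ →L[ℝ] ℂ × ℂ}
    (hT : ∀ v, mfderiv 𝓘(ℝ, ℂ × ℂ) (𝓡 4) (prodChart i ι) q (T v) =
      JX (prodChart i ι q) (mfderiv 𝓘(ℝ, ℂ × ℂ) (𝓡 4) (prodChart i ι) q v))
    (hT' : ∀ v, mfderiv 𝓘(ℝ, ℂ × ℂ) (𝓡 4) (prodChart i ι) q (T' v) =
      JX (prodChart i ι q) (mfderiv 𝓘(ℝ, ℂ × ℂ) (𝓡 4) (prodChart i ι) q v)) :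
    T = T' :=
  coordJ_unique (I := 𝓡 4)
    (fun x => (JX x : TangentSpace (𝓡 4) x →L[ℝ] TangentSpace (𝓡 4) x))
    (injective_mfderiv_prodChart i hι hιimm q) hT hT'

/-- **Compatibility of the two coordinate expressions under the chart change.** If `J₀`, `J₁`
are intertwined with `JX` by the differentials of `prodChart 0 ι`, `prodChart 1 ι`, then
`J₁ (psi x) (dpsi_x v) = dpsi_x (J₀ x v)` for `x.1 ≠ 0`: both sides are sent by the injective
`d(prodChart 1 ι)_{psi x} = d(prodChart 0 ι)_x ∘ dpsi_{psi x}` (chain rule across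
`prodChart 1 ι = prodChart 0 ι ∘ psi`, and `dpsi_{psi x} ∘ dpsi_x = id`) to
`JX (d(prodChart 0 ι)_x v)`. [cite: Wendl2018, §2.3] -/
theorem compat_of_intertwine (hι : ContMDiff ((𝓡 2).prod 𝓘(ℝ, ℂ)) (𝓡 4) ∞ ι)
    (hιimm : ∀ q, Injective (mfderiv ((𝓡 2).prod 𝓘(ℝ, ℂ)) (𝓡 4) ι q))
    {J₀ J₁ : ℂ × ℂ → ℂ × ℂ →L[ℝ] ℂ × ℂ}
    (h₀ : ∀ q v, mfderiv 𝓘(ℝ, ℂ × ℂ) (𝓡 4) (prodChart 0 ι) q (J₀ q v) =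
      JX (prodChart 0 ι q) (mfderiv 𝓘(ℝ, ℂ × ℂ) (𝓡 4) (prodChart 0 ι) q v))
    (h₁ : ∀ q v, mfderiv 𝓘(ℝ, ℂ × ℂ) (𝓡 4) (prodChart 1 ι) q (J₁ q v) =
      JX (prodChart 1 ι q) (mfderiv 𝓘(ℝ, ℂ × ℂ) (𝓡 4) (prodChart 1 ι) q v))
    (x : ℂ × ℂ) (hx : x.1 ≠ 0) (v : ℂ × ℂ) : J₁ (psi x) (dPsi x v) = dPsi x (J₀ x v) := by
  have hy : (psi x).1 ≠ 0 := inv_ne_zero hx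
  have hpt : prodChart 1 ι (psi x) = prodChart 0 ι x := by
    rw [prodChart_one_eq_prodChart_zero_psi ι hy, psi_psi]
  apply injective_mfderiv_prodChart 1 hι hιimm (psi x)
  rw [h₁, mfderiv_prodChart_one_psi_apply hι hx, mfderiv_prodChart_one_psi_apply hι hx,
    dPsi_psi_apply_dPsi hx, dPsi_psi_apply_dPsi hx, h₀, hpt]

/-- **The axis condition from `J`-holomorphicity of the central sphere's chart.** If `Jc` is
intertwined with `JX` by `d(prodChart i ι)` and the slice `z ↦ prodChart i ι (z, 0)` is a
`JX`-holomorphic curve `w` (e.g. `w = u₀` for `i = 0`, `w = v₀` for `i = 1`), then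
`Jc (Z, 0) (ζ, 0) = (I ζ, 0)`: the coordinate curve `z ↦ (z, 0)` is flat `Jc`-holomorphic by the
transfer lemma `isJHolomorphic_comp_iff_coord`, and its derivative is `ζ ↦ (ζ, 0)`.
[cite: Wendl2018, §2.3] -/
theorem axis_of_intertwine (i : Fin 2) (hι : ContMDiff ((𝓡 2).prod 𝓘(ℝ, ℂ)) (𝓡 4) ∞ ι)
    (hιimm : ∀ q, Injective (mfderiv ((𝓡 2).prod 𝓘(ℝ, ℂ)) (𝓡 4) ι q))
    {Jc : ℂ × ℂ → ℂ × ℂ →L[ℝ] ℂ × ℂ}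
    (hint : ∀ q v, mfderiv 𝓘(ℝ, ℂ × ℂ) (𝓡 4) (prodChart i ι) q (Jc q v) =
      JX (prodChart i ι q) (mfderiv 𝓘(ℝ, ℂ × ℂ) (𝓡 4) (prodChart i ι) q v))
    {w : ℂ → X} (hw : ∀ z, prodChart i ι (z, 0) = w z)
    (hJw : IsJHolomorphic (𝓡 4) (fun y => JX y) w) (Z ζ : ℂ) :
    Jc (Z, 0) (ζ, 0) = (Complex.I * ζ, 0) := by
  have hv : Differentiable ℝ (fun z : ℂ => ((z, 0) : ℂ × ℂ)) :=
    differentiable_id.prodMk (differentiable_const _)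
  have hfd : ∀ z ξ : ℂ, fderiv ℝ (fun z : ℂ => ((z, 0) : ℂ × ℂ)) z ξ = (ξ, 0) := fun z ξ => by
    rw [(hasFDerivAt_prodMk_left (𝕜 := ℝ) z (0 : ℂ)).fderiv]
    rfl
  have hcomp : (prodChart i ι ∘ fun z : ℂ => ((z, 0) : ℂ × ℂ)) = w := funext hw
  have h := (isJHolomorphic_comp_iff_coord (I := 𝓡 4)
    (fun x => (JX x : TangentSpace (𝓡 4) x →L[ℝ] TangentSpace (𝓡 4) x)) isOpen_univ
    (contMDiff_prodChart i hι).contMDiffOn (fun q _ => injective_mfderiv_prodChart i hι hιimm q)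
    (Jc := Jc) (fun q _ v => hint q v) hv (fun _ => mem_univ _)).1 (by rw [hcomp]; exact hJw) Z ζ
  rw [hfd, hfd] at h
  exact h.symm

/-- **Transfer of `J`-holomorphicity through a product chart** (pre-instantiated
`isJHolomorphic_comp_iff_isJHolomorphicFlat`): if `Jc` is intertwined with `JX` by
`d(prodChart i ι)` and `v : ℂ → ℂ × ℂ` is real-differentiable, then `prodChart i ι ∘ v` is
`JX`-holomorphic iff `v` is flat `Jc`-holomorphic. [folklore] -/
theorem isJHolomorphic_prodChart_comp_iff (i : Fin 2)
    (hι : ContMDiff ((𝓡 2).prod 𝓘(ℝ, ℂ)) (𝓡 4) ∞ ι)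
    (hιimm : ∀ q, Injective (mfderiv ((𝓡 2).prod 𝓘(ℝ, ℂ)) (𝓡 4) ι q))
    {Jc : ℂ × ℂ → ℂ × ℂ →L[ℝ] ℂ × ℂ}
    (hint : ∀ q v, mfderiv 𝓘(ℝ, ℂ × ℂ) (𝓡 4) (prodChart i ι) q (Jc q v) =
      JX (prodChart i ι q) (mfderiv 𝓘(ℝ, ℂ × ℂ) (𝓡 4) (prodChart i ι) q v))
    {v : ℂ → ℂ × ℂ} (hv : Differentiable ℝ v) :
    IsJHolomorphic (𝓡 4) (fun y => JX y) (prodChart i ι ∘ v) ↔ IsJHolomorphicFlat Jc v :=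
  isJHolomorphic_comp_iff_isJHolomorphicFlat (I := 𝓡 4)
    (fun x => (JX x : TangentSpace (𝓡 4) x →L[ℝ] TangentSpace (𝓡 4) x)) isOpen_univ
    (contMDiff_prodChart i hι).contMDiffOn (fun q _ => injective_mfderiv_prodChart i hι hιimm q)
    (fun q _ w => hint q w) hv (fun _ => mem_univ _)

/-- **Transfer of `J`-holomorphicity through a product chart, at a point**: if `Jc (v z)` is
intertwined with `JX` by `d(prodChart i ι)_{v z}` and `v` is real-differentiable at `z`, then
`d(prodChart i ι ∘ v)(z)(iζ) = JX (d(prodChart i ι ∘ v)(z) ζ)` for all `ζ` iff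
`dv(z)(iζ) = Jc (v z) (dv(z) ζ)` for all `ζ` (`isJHolomorphicAt_iff_coord`). [folklore] -/
theorem isJHolomorphicAt_prodChart_comp_iff (i : Fin 2)
    (hι : ContMDiff ((𝓡 2).prod 𝓘(ℝ, ℂ)) (𝓡 4) ∞ ι)
    (hιimm : ∀ q, Injective (mfderiv ((𝓡 2).prod 𝓘(ℝ, ℂ)) (𝓡 4) ι q))
    {Jc : ℂ × ℂ → ℂ × ℂ →L[ℝ] ℂ × ℂ} {v : ℂ → ℂ × ℂ} {z : ℂ} (hv : DifferentiableAt ℝ v z)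
    (hint : ∀ w, mfderiv 𝓘(ℝ, ℂ × ℂ) (𝓡 4) (prodChart i ι) (v z) (Jc (v z) w) =
      JX (prodChart i ι (v z)) (mfderiv 𝓘(ℝ, ℂ × ℂ) (𝓡 4) (prodChart i ι) (v z) w)) :
    (∀ ζ : ℂ, mfderiv 𝓘(ℝ, ℂ) (𝓡 4) (prodChart i ι ∘ v) z (Complex.I * ζ) =
        JX (prodChart i ι (v z)) (mfderiv 𝓘(ℝ, ℂ) (𝓡 4) (prodChart i ι ∘ v) z ζ)) ↔
      ∀ ζ : ℂ, fderiv ℝ v z (Complex.I * ζ) = Jc (v z) (fderiv ℝ v z ζ) :=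
  isJHolomorphicAt_iff_coord (I := 𝓡 4)
    (fun x => (JX x : TangentSpace (𝓡 4) x →L[ℝ] TangentSpace (𝓡 4) x)) isOpen_univ
    (contMDiff_prodChart i hι).contMDiffOn (fun q _ => injective_mfderiv_prodChart i hι hιimm q)
    hv (mem_univ _) hint

end CoordJ

/-! ### The `SphereACData` of the product neighbourhood -/

section ACData

variable [TopologicalSpace X] [ChartedSpace (EuclideanSpace ℝ (Fin 4)) X] [IsManifold (𝓡 4) ∞ X]

/-- **The `SphereACData` of an embedded `J`-sphere's product neighbourhood.** Let
`JX : AlmostComplexStructure (𝓡 4) ∞ X`, `ι : ℂℙ¹ × ℂ → X` a `C^∞` immersion with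
`ι (θ, 0) = F₀ θ`, where `F₀` is the glued map of the two-chart sphere `(u₀, v₀)`
(`F₀ = u₀ ∘ affineCoordComplex 0` on `{p₀ ≠ 0}`, `F₀ = v₀ ∘ affineCoordComplex 1` on `{p₁ ≠ 0}`)
with `u₀`, `v₀` `JX`-holomorphic. Then there is `𝒥 : SphereACData` — the two chart expressions
of `JX` through `prodChart 0 ι`, `prodChart 1 ι` (`exists_coordJ_prodChart`), compatible under
the chart change (`compat_of_intertwine`) and with the axis condition (`axis_of_intertwine`,
`prodChart 0 ι (z, 0) = u₀ z`, `prodChart 1 ι (w, 0) = v₀ w`) — such that `𝒥.J₀`, `𝒥.J₁` are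
intertwined with `JX` by the differentials of the two product charts (Wendl 2018, §2.3, the
coordinates in the proof of Thm. 2.46). [cite: Wendl2018, §2.3] -/
theorem exists_sphereACData_of_productNbhd (JX : AlmostComplexStructure (𝓡 4) ∞ X)
    (u₀ v₀ : ℂ → X) (F₀ : C(ComplexProjectiveSpace 1, X)) (ι : ComplexProjectiveSpace 1 × ℂ → X)
    (hJu₀ : IsJHolomorphic (𝓡 4) (fun y => JX y) u₀)
    (hJv₀ : IsJHolomorphic (𝓡 4) (fun y => JX y) v₀)
    (hF₀u : ∀ p, CoordNeZero 0 p → F₀ p = u₀ (affineCoordComplex 0 p 0))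
    (hF₀v : ∀ p, CoordNeZero 1 p → F₀ p = v₀ (affineCoordComplex 1 p 0))
    (hι : ContMDiff ((𝓡 2).prod 𝓘(ℝ, ℂ)) (𝓡 4) ∞ ι)
    (hιimm : ∀ q, Injective (mfderiv ((𝓡 2).prod 𝓘(ℝ, ℂ)) (𝓡 4) ι q))
    (hιF : ∀ θ, ι (θ, 0) = F₀ θ) :
    ∃ 𝒥 : SphereACData,
      (∀ q v, mfderiv 𝓘(ℝ, ℂ × ℂ) (𝓡 4) (prodChart 0 ι) q (𝒥.J₀ q v) =
        JX (prodChart 0 ι q) (mfderiv 𝓘(ℝ, ℂ × ℂ) (𝓡 4) (prodChart 0 ι) q v)) ∧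
      (∀ q v, mfderiv 𝓘(ℝ, ℂ × ℂ) (𝓡 4) (prodChart 1 ι) q (𝒥.J₁ q v) =
        JX (prodChart 1 ι q) (mfderiv 𝓘(ℝ, ℂ × ℂ) (𝓡 4) (prodChart 1 ι) q v)) := by
  obtain ⟨J₀, hs₀, hsq₀, hint₀⟩ := exists_coordJ_prodChart JX 0 hι hιimm
  obtain ⟨J₁, hs₁, hsq₁, hint₁⟩ := exists_coordJ_prodChart JX 1 hι hιimm
  exact ⟨⟨J₀, J₁, hs₀, hs₁, hsq₀, hsq₁, compat_of_intertwine JX hι hιimm hint₀ hint₁,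
    axis_of_intertwine JX 0 hι hιimm hint₀ (prodChart_zero_axis hF₀u hιF) hJu₀,
    axis_of_intertwine JX 1 hι hιimm hint₁ (prodChart_one_axis hF₀v hιF) hJv₀⟩, hint₀, hint₁⟩

end ACData

end SphereCR

end Literature.Geometry.Symplectic

end
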